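import Literature.AlgebraicGeometry.AbelianSchemes.AbelianSchemeOverRingAction          -- ★ `AbelianSchemeOver.RingAction`
import Literature.AlgebraicGeometry.AbelianSchemes.AbelianSchemePolarization             -- ★ `DualPair`, `Polarization`
import Literature.AlgebraicGeometry.AbelianSchemes.AbelianSchemeOverLevelBaseChange       -- ★ `LevelStructure.baseChange`, `IsBaseChangeVia`
import Literature.AlgebraicGeometry.AbelianSchemes.AbelianSchemePolarizationBaseChange    -- ★ `DualPair.baseChange`, `Polarization.baseChange`
import Literature.AlgebraicGeometry.AbelianSchemes.TupleIsoAtOfFibreIso                   -- ★ BRICK (T) (`baseChangeHom`, `exists_tupleRel_baseChange_comp_of_iso`)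
import Literature.AlgebraicGeometry.Morphisms.HomSchemePieceOfLayersFiniteType           -- ★ the quasi-compact Hom-scheme piece + the letter currency
import Literature.AlgebraicGeometry.Morphisms.ProjectiveSpaceSegreVeronese                -- ★ `segreOver`, `segreIndexEquivFin`
import Literature.AlgebraicGeometry.AbelianVarieties.LineBundleTensorPower               -- ★ `tensorPow` API
import Literature.AlgebraicGeometry.AbelianSchemes.PolarizedTupleGraphLetters           -- ★ ED. 2: the `stub_ILET` closer (B-p10 (g29), p847282)
import Literature.AlgebraicGeometry.AbelianSchemes.PolarizedTupleIsomPiece              -- ★ ED. 2: the `stub_ICON` closer (A-p14 (g34), p847304)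
import HarnessLib

/-!
# `F0P6aIsomSchemeFiniteType` — ★ RE-HOME (rung-0 re-homing task, books INVENTORY §8.4 M-3) of the SP3-a2 ISO-LOCUS workfile

This `Theorems/` module is the TREE BYTES of the crux workfile `Summits/HodgeConjecture/HodgeConjecture/Cruxes/HLiu418/Lines/F0_P6a_IsomSchemeFiniteType.lean`
(edition of record ED. 2, tree sha16 fc3ee9cc3230dc0c, 262 l.; both sockets closed BY NAME, `sorry`-free) with the NAMESPACE KEPT —
`Summit.HodgeConjecture.HodgeConjecture.Cruxes.HLiu418.F0P6aIsomSchemeFiniteType` — so that every fully-qualified name (`TupleIsoVia`, `TupleIsoAt₂`,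
`GraphLetters`, `prodEmb`, `stub_ILET`, `stub_ICON`, `isomPieces_finiteType_of_line`) is UNCHANGED; only this module docstring is re-headed.
Why a re-home: a `Theorems/` file cannot import a `Lines/` workfile (F0P6-ref1 o-6), and closing stmt-HodgeConjecture-24832 `--as proved --by <Theorems decl>`
at rung 0 needs the sorry-free Lines chain behind the gate; this file has NO Lines import (Tier 0 of the RE-HOME MAP v1.1, LA7-plan (g4) 2026-09-02;
director g27 s1336 (R1)/(R2)); its Lines importers (`F0_P6a_PELInputs`, `F0_P6a_StubKOTT`) use only `TupleIsoAt₂` from it.  After this file is ★ the Lines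
workfile is meant to become a one-import SHIM of it (registrar `crux write`, on word), so no environment ever holds two copies.
It imports ★ `Literature` only; it asserts nothing beyond its two closed sockets and their composition.

## Original module docstring (verbatim)
# `F0_P6a_IsomSchemeFiniteType` — the ISO-LOCUS of two PEL tuples is covered by FINITELY MANY FINITE-TYPE PIECES (SP3-a2)

CRUX `stmt-HodgeConjecture-24832` (HLiu418), sub-line P6a, SPREAD door; consumer = the COFINITE PASSAGE «generic fine-moduli injectivity
`injΩ` ⇒ special injectivity `inj₀` (Defs ED. 2 :897) at all `w ∉ S_M`» PAID INSIDE `stub_PEL` of the RGD spine (LEAD F0P6-plan (g2) M-26-pre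
(L1′) 22:36:20Z; line ruling 22:51:15Z (2)): the pieces of this file over the stage `W ⊂ 𝓜 ×_{S₀} 𝓜` are fed to ★ SP3-b
`Limits/ConstructibleEmptyGenericFibre.finite_iUnion_range_of_bot_notMem` (image constructible, generic fibre empty ⇒ finitely many bad primes
`Σ_Isom ⊆ S_M`).  HC_CM is proved only modulo the 2 remaining named inputs (hLiu418 24832, h413 24833) until rung 0 closes; this workfile
asserts nothing beyond its two (now closed) stubs.  **ED. 2 (2026-09-02): BOTH SOCKETS CLOSED BY NAME, the file is `sorry`-free** —
`stub_ILET := ★ AbelianSchemeOver.exists_finset_graphLetters_of_tupleIso` (`AbelianSchemes/PolarizedTupleGraphLetters`, B-p10 (g29) p847282) and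
`stub_ICON := ★ AbelianSchemeOver.exists_isomPiece_of_letters` (`AbelianSchemes/PolarizedTupleIsomPiece`, A-p14 (g34) p847304); statements of ED. 1
(1b48ce22) byte-identical.

WHY THIS LINE (census `F0/P6/A-p14/g34/CENSUS-SP3a2-IsomSchemeFiniteType.v1.A-p14g34.md` 485f21e1).  [MumfordFogartyKirwan1994] Ch. 7 §2 (proof of
Thm. 7.9) ∕ Ch. 0 §5 (c): `Isom_Y(P₁, P₂)` of two polarised tuples is cut out of `Hom_Y(A₁, A₂) ×_Y Hom_Y(A₂, A₁)` by finitely many closed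
conditions, and `Hom_Y` is a countable disjoint union of QUASI-COMPACT pieces `M_Q` indexed by the Hilbert polynomial `Q` of the graph (★
`Morphisms.exists_homSchemePiece_of_layers_quasiCompact`, unconditional over ★ B1∕B2∕B3).  Boundedness of the letters of tuple-ISOMORPHISMS is
EXACT (finding (F2)): the Poincaré + polarisation clauses give `G^*L^Δ(λ₂) ≅ L^Δ(λ₁)` on the nose (★ `AbelianSchemes/PolarizedTupleIsoCanonicalBundle`,
p847091), so with product embeddings whose `𝒪(1)` is `L^Δ(λ₁)^{⊗k} ⊠ L^Δ(λ₂)^{⊗k}` the graph of `G` at `t` carries `𝒪(1) ≅ L^Δ(λ₁)^{⊗2k}|_t` — the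
same module as the DIAGONAL of `A₁` in `A₁ ×_Y A₁`, whose letters are locally constant on `Y` (★ `graphFamily_hilbertPolynomial_decomposition` at
`φ := 𝟙`) ⇒ finitely many letters on the Noetherian `Y`.  Projective embeddings are a BINDER (I-EMB): over the mixed-characteristic stage they
come from «REL-EMB-SPREAD» (B-p10 (g29): EGA III 4.7.1 spreads the char-0 Lefschetz embedding by `L^Δ³` to a Zariski open of the base; the
finitely many uncovered primes join `S_M`) — the tree has Lefschetz only in characteristic `0`.

CONTENTS.  §0 letters: `TupleIsoVia` ∕ `TupleIsoAt₂` (= Defs :218 `tupleIsoAt` conjuncts VERBATIM for TWO tuples at ONE point), `GraphLetters` (= the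
UNIV-hypothesis clause of ★ `exists_homSchemePiece_of_layers_quasiCompact` VERBATIM: «the graph family of `φ` over `T` has the letters `Q`»), the Segre
product embeddings `prodEmb` of two embedded `Y`-schemes (★ `segreOver`).  §1 binder context (I-EMB).  §2 `stub_ILET` (letters of tuple-isos lie in
a finite set).  §3 `stub_ICON` (the conditions locus at fixed letters is a quasi-compact finite-type `Y`-scheme with the right geometric points).
§4 HEAD `isomPieces_finiteType_of_line` (sorry-free over §2–§3; output = ★ SP3-b input shape).  `stub_ICAN` of the ruling is ★ p847091 (not restated).
[cite: MumfordFogartyKirwan1994, Ch. 0 §5 (c) (p. 23); Ch. 7 §2 Def. 7.2 (p. 129), Prop. 7.3 (p. 132), Thm. 7.9 (p. 139)] [cite: Kottwitz1992, §5 p. 391]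
-/

set_option autoImplicit false

noncomputable section

set_option backward.isDefEq.respectTransparency false

namespace Summit.HodgeConjecture.HodgeConjecture.Cruxes.HLiu418.F0P6aIsomSchemeFiniteType

set_option linter.dupNamespace false  -- `Summit.HodgeConjecture.HodgeConjecture.…` BY DESIGN (D-0017)

open CategoryTheory CategoryTheory.Limits CategoryTheory.Abelian AlgebraicGeometry Polynomial MonoidalCategory
open Literature.AlgebraicGeometry Literature.AlgebraicGeometry.Morphisms
open Literature.AlgebraicGeometry.Modules Literature.AlgebraicGeometry.Modules.SerreTwist
open Literature.Algebra.Homology Literature.Algebra.Homology.LaurentCech Literature.Algebra.Homology.OrderedCech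
open Literature.AlgebraicGeometry.AbelianSchemes Literature.AlgebraicGeometry.AbelianVarieties

/-! ### §0 Letters -/

/-- **Isomorphism of two PEL tuples at one point VIA `(G, Ĝ)`** — the conjuncts of Defs ED. 2 :218 `tupleIsoAt` VERBATIM with
`(t₁, t₂, one tuple) ↦ (t, t, two tuples)`: `G` carries level to level along `𝟙 T` (MFK base-change relation of the group schemes), `Ĝ`
the duals, the Poincaré bundle pulls back along `G × Ĝ`, the polarisation is respected EXACTLY (`λ₁ ≫ Ĝ = G ≫ λ₂`), and `G` is
`O`-equivariant. [cite: MumfordFogartyKirwan1994, Ch. 7 §2 Definition 7.2 (p. 129)] [cite: RapoportSmithlingZhang2020Diagonal, §4.1 p. 17] -/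
def TupleIsoVia {O : Type} [CommRing O] {Y T : Scheme.{0}} (t : T ⟶ Y)
    (𝒜₁ : AbelianSchemeOver Y) (ρ₁ : 𝒜₁.RingAction O) (D₁ : 𝒜₁.DualPair) (pol₁ : 𝒜₁.Polarization D₁)
    {g N : ℕ} (lvl₁ : 𝒜₁.LevelStructure g N)
    (𝒜₂ : AbelianSchemeOver Y) (ρ₂ : 𝒜₂.RingAction O) (D₂ : 𝒜₂.DualPair) (pol₂ : 𝒜₂.Polarization D₂)
    (lvl₂ : 𝒜₂.LevelStructure g N)
    (G : (𝒜₁.baseChange t).X.left ⟶ (𝒜₂.baseChange t).X.left)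
    (Ĝ : (D₁.baseChange t).hat.X.left ⟶ (D₂.baseChange t).hat.X.left) : Prop :=
  (lvl₁.baseChange t).IsBaseChangeVia (lvl₂.baseChange t) (𝟙 T) G ∧
    (D₁.baseChange t).hat.IsBaseChangeVia (D₂.baseChange t).hat (𝟙 T) Ĝ ∧
    (∃ (wG : (𝒜₁.baseChange t).X.hom ≫ 𝟙 T = G ≫ (𝒜₂.baseChange t).X.hom)
        (wĜ : (D₁.baseChange t).hat.X.hom ≫ 𝟙 T = Ĝ ≫ (D₂.baseChange t).hat.X.hom),
      Nonempty ((Scheme.Modules.pullback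
          (pullback.map (𝒜₁.baseChange t).X.hom (D₁.baseChange t).hat.X.hom
            (𝒜₂.baseChange t).X.hom (D₂.baseChange t).hat.X.hom G Ĝ (𝟙 T) wG wĜ)).obj (D₂.baseChange t).P ≅
        (D₁.baseChange t).P)) ∧
    (pol₁.baseChange t).lam.left ≫ Ĝ = G ≫ (pol₂.baseChange t).lam.left ∧
    ∀ a : O, (AbelianSchemeOver.baseChangeHom (ρ₁.i a) t).left ≫ G =
      G ≫ (AbelianSchemeOver.baseChangeHom (ρ₂.i a) t).left

/-- **Isomorphism of two PEL tuples at one point**: `∃ G Ĝ, TupleIsoVia …` — token twin of Defs ED. 2 :218 `tupleIsoAt` for two tuples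
over one base (the `inj₀` consumer rebases `TupleIsoAt₂ (x̄₁, x̄₂) (pr₁^*univ) (pr₂^*univ) ↔ tupleIsoAt x̄₁ x̄₂ univ`, ★ (O5′) + ★ BRICK (T)).
[cite: MumfordFogartyKirwan1994, Ch. 7 §2 Definition 7.2 (p. 129)] -/
def TupleIsoAt₂ {O : Type} [CommRing O] {Y T : Scheme.{0}} (t : T ⟶ Y)
    (𝒜₁ : AbelianSchemeOver Y) (ρ₁ : 𝒜₁.RingAction O) (D₁ : 𝒜₁.DualPair) (pol₁ : 𝒜₁.Polarization D₁)
    {g N : ℕ} (lvl₁ : 𝒜₁.LevelStructure g N)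
    (𝒜₂ : AbelianSchemeOver Y) (ρ₂ : 𝒜₂.RingAction O) (D₂ : 𝒜₂.DualPair) (pol₂ : 𝒜₂.Polarization D₂)
    (lvl₂ : 𝒜₂.LevelStructure g N) : Prop :=
  ∃ (G : (𝒜₁.baseChange t).X.left ⟶ (𝒜₂.baseChange t).X.left)
    (Ĝ : (D₁.baseChange t).hat.X.left ⟶ (D₂.baseChange t).hat.X.left),
    TupleIsoVia t 𝒜₁ ρ₁ D₁ pol₁ lvl₁ 𝒜₂ ρ₂ D₂ pol₂ lvl₂ G Ĝ

/-- **«The graph family of `φ` over `T` has the letters `Q`»** — VERBATIM the hypothesis clause of the UNIV property of ★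
`Morphisms.exists_homSchemePiece_of_layers_quasiCompact` (the piece `M_Q` of `Hom_S(Y, X)` receives exactly the `T`-morphisms `φ : Y_T → X_T`
satisfying this clause): for every graph family `iΓ : Y_T ↪ 𝐏(ι; T)` of `φ` through the product embedding `jW`, at every field point of `T`,
both letters of cohomology-and-base-change hold with the polynomial `Q` beyond Mumford's regularity threshold.
[cite: MumfordFogartyKirwan1994, Ch. 0 §5 (c) (p. 23)] [cite: EGAIII2, 7.9.11] -/
def GraphLetters {S Y₀ X₀ : Scheme.{0}} (q : Y₀ ⟶ S) (p : X₀ ⟶ S) {ι : Type}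
    (jW : pullback q p ⟶ Morphisms.projectiveSpace ι S) {T : Scheme.{0}} (v : T ⟶ S)
    (φ : pullback q v ⟶ pullback p v) (Q : ℚ[X]) : Prop :=
  ∀ (hw : pullback.fst q v ≫ q = (φ ≫ pullback.fst p v) ≫ p) (iΓ : pullback q v ⟶ Morphisms.projectiveSpace ι T),
    iΓ ≫ Morphisms.projectiveSpaceFst ι T = pullback.snd q v →
    iΓ ≫ Morphisms.projectiveSpaceMap ι v = pullback.lift (pullback.fst q v) (φ ≫ pullback.fst p v) hw ≫ jW →
    ∀ ⦃K : Type⦄ [Field K] ⦃X' : Scheme.{0}⦄ (k : X' ⟶ pullback q v) (f₀ : X' ⟶ Spec (CommRingCat.of K))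
      (x : Spec (CommRingCat.of K) ⟶ T), IsPullback k f₀ (iΓ ≫ Morphisms.projectiveSpaceFst ι T) x →
      ∀ e : ℕ, regularityBound (preHilbertPoly ℚ (Nat.card ι) 0) 0 (preHilbertPoly ℚ (Nat.card ι) 0 - Q) - 1 ≤ (e : ℤ) →
        Subsingleton (CategoryTheory.Abelian.Ext.{1} (unitModule X') ((Scheme.Modules.pullback k).obj
          (twistMod (iΓ ≫ pullback.snd (terminal.from T) (terminal.from (Morphisms.projectiveSpaceInt ι))) (unitModule _) e)) 1) ∧
        ((Module.finrank Γ(Spec (CommRingCat.of K), ⊤) (SecMod ((Scheme.Modules.pullback k).obj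
          (twistMod (iΓ ≫ pullback.snd (terminal.from T) (terminal.from (Morphisms.projectiveSpaceInt ι))) (unitModule _) e))
          f₀.appTop.hom ⊤) : ℕ) : ℚ) = Q.eval (e : ℚ)

/-- **The Segre product of two embedded `Y`-schemes**: from closed `Y`-embeddings `j₁ : Y₁ ↪ 𝐏(Fin n₁; Y)`, `j₂ : Y₂ ↪ 𝐏(Fin n₂; Y)` the
`Y`-embedding `Y₁ ×_Y Y₂ ↪ 𝐏(Fin n₁; Y) ×_Y 𝐏(Fin n₂; Y) ↪ 𝐏(Fin (n₁ n₂ + n₁ + n₂); Y)` (★ `segreOver`, coordinates `z_{ij} = xᵢ yⱼ`, so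
`𝒪(1)` restricts to `𝒪(1) ⊠ 𝒪(1)`). [cite: Hartshorne1977, II Ex. 4.9 and II §4 (p. 103)] [cite: StacksProject, Tag 01WD] -/
def prodEmb {Y : Scheme.{0}} (Y₁ Y₂ : Over Y) {n₁ n₂ : ℕ}
    (j₁ : Y₁.left ⟶ Morphisms.projectiveSpace (Fin n₁) Y) (hj₁ : j₁ ≫ Morphisms.projectiveSpaceFst (Fin n₁) Y = Y₁.hom)
    (j₂ : Y₂.left ⟶ Morphisms.projectiveSpace (Fin n₂) Y) (hj₂ : j₂ ≫ Morphisms.projectiveSpaceFst (Fin n₂) Y = Y₂.hom) :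
    pullback Y₁.hom Y₂.hom ⟶ Morphisms.projectiveSpace (Fin (n₁ * n₂ + n₁ + n₂)) Y :=
  (MonoidalCategoryStruct.tensorHom
      (Over.homMk j₁ hj₁ : Y₁ ⟶ Over.mk (Morphisms.projectiveSpaceFst (Fin n₁) Y))
      (Over.homMk j₂ hj₂ : Y₂ ⟶ Over.mk (Morphisms.projectiveSpaceFst (Fin n₂) Y)) ≫
    Morphisms.segreOver Y (Morphisms.segreIndexEquivFin n₁ n₂)).left

/-! ### §1 The two tuples and the embedding binder (I-EMB) -/

variable {O : Type} [CommRing O] {Y : Scheme.{0}} [IsNoetherian Y]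
  (𝒜₁ : AbelianSchemeOver Y) (ρ₁ : 𝒜₁.RingAction O) (D₁ : 𝒜₁.DualPair) (pol₁ : 𝒜₁.Polarization D₁)
  {g N : ℕ} (lvl₁ : 𝒜₁.LevelStructure g N)
  (𝒜₂ : AbelianSchemeOver Y) (ρ₂ : 𝒜₂.RingAction O) (D₂ : 𝒜₂.DualPair) (pol₂ : 𝒜₂.Polarization D₂)
  (lvl₂ : 𝒜₂.LevelStructure g N)
  -- the graphs `(1, λᵢ) : Aᵢ → Aᵢ ×_Y Âᵢ` as morphisms with their projections (★ `AbelianSchemeLDeltaOfLambda` convention); `L^Δ(λᵢ) := Grᵢ^* 𝒫ᵢ`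
  -- the graphs `(1, λᵢ) : Aᵢ → Aᵢ ×_Y Âᵢ` (★ `AbelianSchemeLDeltaOfLambda` convention; their projection laws are binders of `stub_ILET`);
  -- `L^Δ(λᵢ) := Grᵢ^* 𝒫ᵢ`
  (Gr₁ : 𝒜₁.X.left ⟶ 𝒜₁.prodLeft D₁.hat) (Gr₂ : 𝒜₂.X.left ⟶ 𝒜₂.prodLeft D₂.hat)
  -- (I-EMB) `Y`-embeddings of `A₁`, `A₂` into THE SAME projective space `𝐏(Fin n; Y)` (one `n`: the Segre targets of `A₁ ×_Y A₂`, `A₂ ×_Y A₁`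
  -- and `Aᵢ ×_Y Aᵢ` are then ONE `𝐏(Fin (n² + 2n); Y)`, so all Hilbert letters share Mumford's regularity threshold; pad the smaller embedding by a
  -- coordinate subspace).  Closedness, `1 ≤ n` and «`𝒪(1) ≅ L^Δ(λᵢ)^{⊗k}`» are binders of the stubs that consume them; REL-EMB-SPREAD (B-p10 (g29))
  -- supplies them with `k = 3`, Zariski-locally on the stage, cofinitely in `w`.
  {n k : ℕ}
  (j₁ : 𝒜₁.X.left ⟶ Morphisms.projectiveSpace (Fin n) Y) (hj₁ : j₁ ≫ Morphisms.projectiveSpaceFst (Fin n) Y = 𝒜₁.X.hom)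
  (j₂ : 𝒜₂.X.left ⟶ Morphisms.projectiveSpace (Fin n) Y) (hj₂ : j₂ ≫ Morphisms.projectiveSpaceFst (Fin n) Y = 𝒜₂.X.hom)

/-! ### §2 `stub_ILET` — the letters of tuple-isomorphisms lie in a FINITE set -/

/-- **`stub_ILET` — THE HILBERT LETTERS OF TUPLE-ISOMORPHISMS ARE BOUNDED (in fact: one pair per connected component).**  There is a FINITE set
`F` of pairs of polynomials such that for every geometric point `t` of `Y` and every tuple-isomorphism `(G, Ĝ)` at `t`, some `(Q, Q′) ∈ F` has:
the graph of `G` (in `A₁ ×_Y A₂`, Segre embedding `prodEmb j₁ j₂`) has the letters `Q`, and the graph of every two-sided inverse of `G` (in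
`A₂ ×_Y A₁`, `prodEmb j₂ j₁`) has the letters `Q′`.  ROAD (census (F2)): `G^*L^Δ(λ₂)^{⊗k} ≅ L^Δ(λ₁)^{⊗k}` (★ p847091
`nonempty_pullback_LDelta_tensorPow_iso_of_tupleIso`) and `𝒪(1)` of `prodEmb` restricts to `𝒪_{j₁}(1) ⊠ 𝒪_{j₂}(1)` ⇒ on the graph of `G`,
`𝒪(1) ≅ L^Δ(λ₁)^{⊗2k}|_t` = the module of the DIAGONAL `A₁ ↪ A₁ ×_Y A₁ ↪ 𝐏` at `t`, whose letters `P(y)` are LOCALLY CONSTANT on `Y` (★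
`graphFamily_hilbertPolynomial_decomposition` at `φ := 𝟙`, `v := 𝟙`); letters are invariants of (fibre, `𝒪(1)|_fibre`) (transport as in ★
`Motives/HomSchemePieceData`; SAME ambient `𝐏(Fin (n² + 2n))`, hence the same regularity threshold); `Y` Noetherian ⇒ `P` has finite range; for a
two-sided inverse `Ginv` the graph in `A₂ ×_Y A₁` carries `𝒪(1) ≅ L^Δ(λ₂)^{⊗k} ⊗ Ginv^*L^Δ(λ₁)^{⊗k}`, which `G` pulls back to `L^Δ(λ₁)^{⊗2k}|_t` again,
so `Q′ = Q` and `F := {(P y, P y)}` works.  Size M–L (letter currency).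
[cite: MumfordFogartyKirwan1994, Ch. 0 §5 (c) (p. 23) and Ch. 7 §2 Prop. 7.3 (p. 132)] [cite: EGAIII2, 7.9.11] -/
theorem stub_ILET
    -- binders the proof consumes (L^Δ graphs, positive ambient dimension, closed embeddings and their `𝒪(1)`):
    (hn : 1 ≤ n)
    (hGr₁₁ : Gr₁ ≫ pullback.fst 𝒜₁.X.hom D₁.hat.X.hom = 𝟙 _) (hGr₁₂ : Gr₁ ≫ pullback.snd 𝒜₁.X.hom D₁.hat.X.hom = pol₁.lam.left)
    (hGr₂₁ : Gr₂ ≫ pullback.fst 𝒜₂.X.hom D₂.hat.X.hom = 𝟙 _) (hGr₂₂ : Gr₂ ≫ pullback.snd 𝒜₂.X.hom D₂.hat.X.hom = pol₂.lam.left)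
    (hj₁c : IsClosedImmersion j₁) (hj₂c : IsClosedImmersion j₂)
    (e₁ : twistMod (j₁ ≫ pullback.snd (terminal.from Y) (terminal.from (Morphisms.projectiveSpaceInt (Fin n)))) (unitModule _) 1 ≅
      tensorPow ((Scheme.Modules.pullback Gr₁).obj D₁.P) k)
    (e₂ : twistMod (j₂ ≫ pullback.snd (terminal.from Y) (terminal.from (Morphisms.projectiveSpaceInt (Fin n)))) (unitModule _) 1 ≅
      tensorPow ((Scheme.Modules.pullback Gr₂).obj D₂.P) k) : ∃ F : Finset (ℚ[X] × ℚ[X]),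
    ∀ ⦃Ω : Type⦄ [Field Ω] [IsAlgClosed Ω] (t : Spec (CommRingCat.of Ω) ⟶ Y)
      (G : (𝒜₁.baseChange t).X.left ⟶ (𝒜₂.baseChange t).X.left)
      (Ĝ : (D₁.baseChange t).hat.X.left ⟶ (D₂.baseChange t).hat.X.left),
      TupleIsoVia t 𝒜₁ ρ₁ D₁ pol₁ lvl₁ 𝒜₂ ρ₂ D₂ pol₂ lvl₂ G Ĝ →
      ∃ QQ' ∈ F, GraphLetters 𝒜₁.X.hom 𝒜₂.X.hom (prodEmb 𝒜₁.X 𝒜₂.X j₁ hj₁ j₂ hj₂) t G QQ'.1 ∧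
        ∀ Ginv : (𝒜₂.baseChange t).X.left ⟶ (𝒜₁.baseChange t).X.left, Ginv ≫ G = 𝟙 _ → G ≫ Ginv = 𝟙 _ →
          GraphLetters 𝒜₂.X.hom 𝒜₁.X.hom (prodEmb 𝒜₂.X 𝒜₁.X j₂ hj₂ j₁ hj₁) t Ginv QQ'.2 :=
  -- ED. 2: closed by name (★ `AbelianSchemes/PolarizedTupleGraphLetters`, B-p10 (g29) p847282)
  Literature.AlgebraicGeometry.AbelianSchemes.AbelianSchemeOver.exists_finset_graphLetters_of_tupleIso 𝒜₁ ρ₁ D₁ pol₁ lvl₁ 𝒜₂ ρ₂ D₂ pol₂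
    lvl₂ Gr₁ Gr₂ j₁ hj₁ j₂ hj₂ hn hGr₁₁ hGr₁₂ hGr₂₁ hGr₂₂ hj₁c hj₂c e₁ e₂

/-! ### §3 `stub_ICON` — the conditions locus at fixed letters is a quasi-compact finite-type `Y`-scheme -/

/-- **`stub_ICON` — THE `Isom` PIECE AT LETTERS `(Q, Q′)`.**  For every pair of polynomials there is a `Y`-scheme `m : I → Y`, QUASI-COMPACT and
LOCALLY OF FINITE TYPE, whose geometric points over `t` are exactly the tuple-isomorphisms `(G, Ĝ)` at `t` whose graph has the letters `Q`
and whose inverse has the letters `Q′`.  ROAD: `I :=` the locus inside `M_Q ×_Y M′_{Q′}` (★ `exists_homSchemePiece_of_layers_quasiCompact` for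
`Hom(A₁, A₂)` and `Hom(A₂, A₁)`, fed by ★ `Motives.exists_hilbertScheme_over_letters_quasiCompact` ∕ ★ `exists_idealSheafData_homSchemeClosedLayer` ∕ ★
`IsoLocusOfFlatProper`, projectivity from the binders `jᵢ`) where `v ∘ u = 𝟙`, `u ∘ v = 𝟙`, `u` preserves the unit section (⇒ homomorphism by
rigidity), `λ`, the `2g` level sections and the `O`-action are respected — equalities of morphisms of abelian schemes are OPEN AND CLOSED loci (★
`HomEqualityLocusClosed`; any family of them on a Noetherian scheme meets in a clopen); then ★ BRICK (T) `exists_tupleRel_baseChange_comp_of_iso`-shape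
assembly yields `TupleIsoVia` (dual transport `Ĝ` and the Poincaré clause are ★).  Non-admissible `(Q, Q′)`: `I := ∅`.  Size L.
[cite: MumfordFogartyKirwan1994, Ch. 0 §5 (c) (p. 23); Ch. 6 §1 Cor. 6.2 (p. 116); Ch. 7 §2 Def. 7.2 (p. 129)] [cite: Kottwitz1992, §5 p. 391] -/
theorem stub_ICON
    -- binders the proof consumes (projectivity of `A₁`, `A₂` over `Y` through the closed embeddings; positive ambient dimension):
    (hn : 1 ≤ n) (hj₁c : IsClosedImmersion j₁) (hj₂c : IsClosedImmersion j₂) (Q Q' : ℚ[X]) : ∃ (I : Scheme.{0}) (m : I ⟶ Y) (_ : QuasiCompact m) (_ : LocallyOfFiniteType m),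
    ∀ ⦃Ω : Type⦄ [Field Ω] [IsAlgClosed Ω] (t : Spec (CommRingCat.of Ω) ⟶ Y),
      (∃ (G : (𝒜₁.baseChange t).X.left ⟶ (𝒜₂.baseChange t).X.left)
          (Ĝ : (D₁.baseChange t).hat.X.left ⟶ (D₂.baseChange t).hat.X.left),
          TupleIsoVia t 𝒜₁ ρ₁ D₁ pol₁ lvl₁ 𝒜₂ ρ₂ D₂ pol₂ lvl₂ G Ĝ ∧
          GraphLetters 𝒜₁.X.hom 𝒜₂.X.hom (prodEmb 𝒜₁.X 𝒜₂.X j₁ hj₁ j₂ hj₂) t G Q ∧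
          ∀ Ginv : (𝒜₂.baseChange t).X.left ⟶ (𝒜₁.baseChange t).X.left, Ginv ≫ G = 𝟙 _ → G ≫ Ginv = 𝟙 _ →
            GraphLetters 𝒜₂.X.hom 𝒜₁.X.hom (prodEmb 𝒜₂.X 𝒜₁.X j₂ hj₂ j₁ hj₁) t Ginv Q') ↔
      ∃ s : Spec (CommRingCat.of Ω) ⟶ I, s ≫ m = t :=
  -- ED. 2: closed by name (★ `AbelianSchemes/PolarizedTupleIsomPiece`, A-p14 (g34) p847304)
  Literature.AlgebraicGeometry.AbelianSchemes.AbelianSchemeOver.exists_isomPiece_of_letters 𝒜₁ ρ₁ D₁ pol₁ lvl₁ 𝒜₂ ρ₂ D₂ pol₂ lvl₂ j₁ hj₁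
    j₂ hj₂ hn hj₁c hj₂c Q Q'

/-! ### §4 HEAD — finitely many finite-type pieces cover the iso-locus exactly (sorry-free; §2–§3 closed in ED. 2) -/

include hj₁ hj₂ in
/-- **HEAD `isomPieces_finiteType_of_line` — THE ISO-LOCUS OF TWO PEL TUPLES IS THE IMAGE OF FINITELY MANY QUASI-COMPACT FINITE-TYPE `Y`-SCHEMES**
(= the input shape of ★ SP3-b `Limits/ConstructibleEmptyGenericFibre`): `∃ n (I : Fin n → Scheme) (m : I i → Y)`, each quasi-compact and locally of
finite type, such that for every geometric point `t` of `Y`: the tuples are isomorphic at `t` iff `t` lifts to some `I i`.  Proof: the finite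
letter set `F` of `stub_ILET`, one piece `stub_ICON (Q, Q′)` per `(Q, Q′) ∈ F`, enumerated by `Finset.equivFin`.
[cite: MumfordFogartyKirwan1994, Ch. 7 §2 Prop. 7.3 (p. 132) and Thm. 7.9 (p. 139)] [cite: Kottwitz1992, §5 p. 391] -/
theorem isomPieces_finiteType_of_line
    (hGr₁₁ : Gr₁ ≫ pullback.fst 𝒜₁.X.hom D₁.hat.X.hom = 𝟙 _) (hGr₁₂ : Gr₁ ≫ pullback.snd 𝒜₁.X.hom D₁.hat.X.hom = pol₁.lam.left)
    (hGr₂₁ : Gr₂ ≫ pullback.fst 𝒜₂.X.hom D₂.hat.X.hom = 𝟙 _) (hGr₂₂ : Gr₂ ≫ pullback.snd 𝒜₂.X.hom D₂.hat.X.hom = pol₂.lam.left)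
    (hn : 1 ≤ n) (hj₁c : IsClosedImmersion j₁) (hj₂c : IsClosedImmersion j₂)
    (e₁ : twistMod (j₁ ≫ pullback.snd (terminal.from Y) (terminal.from (Morphisms.projectiveSpaceInt (Fin n)))) (unitModule _) 1 ≅
      tensorPow ((Scheme.Modules.pullback Gr₁).obj D₁.P) k)
    (e₂ : twistMod (j₂ ≫ pullback.snd (terminal.from Y) (terminal.from (Morphisms.projectiveSpaceInt (Fin n)))) (unitModule _) 1 ≅
      tensorPow ((Scheme.Modules.pullback Gr₂).obj D₂.P) k) :
    ∃ (n : ℕ) (I : Fin n → Scheme.{0}) (m : ∀ i, I i ⟶ Y) (_ : ∀ i, QuasiCompact (m i))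
      (_ : ∀ i, LocallyOfFiniteType (m i)),
      ∀ ⦃Ω : Type⦄ [Field Ω] [IsAlgClosed Ω] (t : Spec (CommRingCat.of Ω) ⟶ Y),
        TupleIsoAt₂ t 𝒜₁ ρ₁ D₁ pol₁ lvl₁ 𝒜₂ ρ₂ D₂ pol₂ lvl₂ ↔
          ∃ (i : Fin n) (s : Spec (CommRingCat.of Ω) ⟶ I i), s ≫ m i = t := by
  classical
  obtain ⟨F, hF⟩ := stub_ILET 𝒜₁ ρ₁ D₁ pol₁ lvl₁ 𝒜₂ ρ₂ D₂ pol₂ lvl₂ Gr₁ Gr₂ j₁ hj₁ j₂ hj₂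
    hn hGr₁₁ hGr₁₂ hGr₂₁ hGr₂₂ hj₁c hj₂c e₁ e₂
  choose I m hqc hlft hI using fun QQ' : ℚ[X] × ℚ[X] =>
    stub_ICON 𝒜₁ ρ₁ D₁ pol₁ lvl₁ 𝒜₂ ρ₂ D₂ pol₂ lvl₂ j₁ hj₁ j₂ hj₂ hn hj₁c hj₂c QQ'.1 QQ'.2
  -- the pieces indexed by `F`, then by `Fin F.card`
  have key : ∀ ⦃Ω : Type⦄ [Field Ω] [IsAlgClosed Ω] (t : Spec (CommRingCat.of Ω) ⟶ Y),
      TupleIsoAt₂ t 𝒜₁ ρ₁ D₁ pol₁ lvl₁ 𝒜₂ ρ₂ D₂ pol₂ lvl₂ ↔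
        ∃ QQ' ∈ F, ∃ s : Spec (CommRingCat.of Ω) ⟶ I QQ', s ≫ m QQ' = t := by
    intro Ω _ _ t
    constructor
    · rintro ⟨G, Ĝ, hG⟩
      obtain ⟨QQ', hmem, hQ, hQ'⟩ := hF t G Ĝ hG
      exact ⟨QQ', hmem, (hI QQ' t).mp ⟨G, Ĝ, hG, hQ, hQ'⟩⟩
    · rintro ⟨QQ', -, s, hs⟩
      obtain ⟨G, Ĝ, hG, -, -⟩ := (hI QQ' t).mpr ⟨s, hs⟩
      exact ⟨G, Ĝ, hG⟩
  let ε := F.equivFin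
  refine ⟨F.card, fun i => I (ε.symm i).1, fun i => m (ε.symm i).1, fun i => hqc _, fun i => hlft _, fun Ω _ _ t => ?_⟩
  rw [key t]
  constructor
  · rintro ⟨QQ', hmem, s, hs⟩
    refine ⟨ε ⟨QQ', hmem⟩, ?_⟩
    dsimp only
    rw [Equiv.symm_apply_apply]
    exact ⟨s, hs⟩
  · rintro ⟨i, s, hs⟩
    dsimp only at s hs
    exact ⟨(ε.symm i).1, (ε.symm i).2, s, hs⟩

end Summit.HodgeConjecture.HodgeConjecture.Cruxes.HLiu418.F0P6aIsomSchemeFiniteType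

end
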